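import Summits.CriticalPhenomena.PercolationContinuityZ3.Theorems.PercNearOneGluingNoHeavyQuantGatedSliceMixLawPooled
import HarnessLib

/-!
# QUANT lane R8, T-DEC, leg (III), blob case — `LawDec.GatedSliceMixLaw'` in REGIME B, cell B-M with the top EQUAL to the weak-mid atom
# (`k₂ = h`): the SATURATED-MID sub-cell PROVED — the mixture at the kink, both for a dear and for a cheap unshifted low

builds on p205010 (kernel theorem, internal audit signed; external expert review pending)

Support file (`--supports stmt-CriticalPhenomena-4575`), QUANT lane seat prim-quant-census-2 (gen 61), rung R8 of
`run/shared/lean/prim/quant/LADDER.md`.  Memo `run/shared/lean/prim/quant/prim-quant-census-2-g61/REGIME-B-TOP-G61.md` §3–§4.  Theorems only,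
standard axioms, no sorries.  Tools: `…QuantGatedSliceMixLawPooled` (the pooled inequality `pooled_dear` / `pooled_cheap`),
`…QuantGatedSliceMixLawExchange` (`flowAtT_pair`, `movedTwoPoint_apply`, `gatedSliceMixLaw_conclusion_of_flowAtT`), `flowAtT_of_giants`.

THE CELL (sub-cell of the typer's `LawDec.MixLawRegimeB`, `T/…QuantGatedSliceMixLawCells`; lead g32's ruling INBOX 02:39Z: cell B-M is
census-2's).  Frame of `GatedSliceMixLaw'` with `k₂ = h` (the top of the two-point law IS the weak-mid atom), `k₁` and `ℓ = k₁ + a` `t`-lows,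
`h` a mid (`t ≤ 2h`), `h + a ≥ j + 1` the ONE giant of the mixture `Q_θ = θ·W_h + (1−θ)·P`, `g < 1` (`¬DEC(W_h)` gives it,
`decAtT_weakMidLaw_of_giant`).  `U_d = usage y t j ℓ h`, `U₁ = usage y t j k₁ h`, `u = y/(1−y)`, masses `m₁, m₁', m₂, m₂'` of
`movedTwoPoint_apply`, `W(0) = 1 − S/h`, `W(h) = (S/h)(1−g)`, `W(h+a) = (S/h)g`.

THE STRUCTURE (memo §3; exact census of the seat, ≈ 45 000 instances, two generators + arm-3 g64's files, 0 exceptions).  With one mid and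
one giant the transportation problem of a law is a fractional knapsack; by LP duality `P ∈ D ⟺ V(b) ≤ 0 ∀ b ≥ 0`,
`V(b) = Σ_lows min(u, rate·b)·mass − b·m₂ − m₂'` (price `b` on the mid, `1` on the giant).  `V(1) ≤ 0` is the pooled inequality (always
true, `…Pooled`); `W_h` has price slack exactly for `b ≥ 1` (`u·W(0) − W(h+a) ≤ W(h)` ⟸ `y·h ≤ S`).  Hence if the right slope
`Δ = V'(1⁻) = U_d m₁' + [U₁ < u]·U₁ m₁ − m₂` is `≥ 0` (the mid is SATURATED by the lows that prefer it — every genuine instance of the cell)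
the mixture at `θ = Δ/(Δ + W(h))` is DEC: THIS FILE.  (If `Δ < 0` the moved law must be DEC by itself — the θ = 0 half, INBOX 03:1xZ.)

THE CERTIFICATES.  DEAR `k₁` (`y(h − k₁) ≤ t − 2k₁`: heavy pair or incompatible): the shifted low fills the mid exactly
(`(1−θ)U_d m₁' = θW(h) + (1−θ)m₂`), `k₁` and every zero ride the giant; the giant inequality
`u(θW(0) + (1−θ)(z + m₁)) ≤ θW(h+a) + (1−θ)m₂'` is `θ(uW(0) − W(h+a)) ≤ θW(h) = (1−θ)Δ ≤ (1−θ)(m₂' − uz − um₁)` by `pooled_dear`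
(arm-3 g64's kink `θ_d`, lead g32's K1).  CHEAP `k₁` (`t − 2k₁ ≤ y(h − k₁)`): both lows fill the mid, zeros ride the giant,
`Δ = U_d m₁' + U₁ m₁ − m₂`, `pooled_cheap` (kink `θ_all` / K2).  `¬DEC(W_h)` is used only as `g < 1`.

* **`LawDec.gatedSliceMixLaw_regimeB_top_dear`**, **`LawDec.gatedSliceMixLaw_regimeB_top_cheap`** — the conclusion of `GatedSliceMixLaw'`
  (verbatim `∃ θ, 0 ≤ θ ∧ θ < 1 ∧ DECAtT …`) on the two saturated sub-cells of cell B-M with `k₂ = h`.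

[this work]; exchange architecture: prim-quant-stmt g30; flow form / criterion E: prim-quant-stmt g22–g27, arm-1 g39; kink map: arm-3 g63–g64,
lead g31–g32 (this lane).  Nothing here is cited as a published result.  The gluing rows served [cite: KozmaNitzan2024, Conjecture 3 (p. 15)];
product measure [cite: Grimmett1999, §1.3 p. 10].
-/

noncomputable section

namespace Summit.CriticalPhenomena.PercolationContinuityZ3.Theorems

namespace Quant

open Finset

/-- the two-point law `{lo, hi; g}` (as in `…QuantLawDEC`) -/
local notation3 "TP[" lo ", " hi ", " g ", " h "]" =>
  (g : ℝ) * (if (h : ℕ) = (hi : ℕ) then (1 : ℝ) else 0) + (1 - (g : ℝ)) * (if (h : ℕ) = (lo : ℕ) then (1 : ℝ) else 0)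

namespace LawDec

/-! ### Regime B with the top equal to the weak-mid atom: the saturated (mixture) sub-cell -/

set_option maxHeartbeats 400000 in
/-- **REGIME B, `k₂ = h`, DEAR `k₁`, SATURATED mid — the conclusion of `GatedSliceMixLaw'`.**  Frame of `MixLawRegimeB` with the top of the
two-point law EQUAL to the weak-mid atom (`k₂ = h`, so the mixture `Q_θ = θ·W_h + (1−θ)·P` has ONE mid `h` and ONE giant `h + a`); the
shifted low `ℓ = k₁ + a` a `t`-low; `g < 1` (else `W_h` is DEC, `decAtT_weakMidLaw_of_giant`); the unshifted low DEAR at `h`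
(`y(h − k₁) ≤ t − 2k₁`: heavy pair or incompatible, so it rides the giant at `u = y/(1−y)`); and the mid SATURATED by the shifted low alone
(`m₂ ≤ U_d·m₁'`, `U_d = usage y t j ℓ h`).  Certificate: `θ = Δ/(Δ + W(h))`, `Δ = U_d m₁' − m₂ ≥ 0` (the kink at which `ℓ` exactly fills the
mid of `Q_θ`); `k₁` and every zero ride the giant `h + a`; the giant inequality is `θ(u·W(0) − W(h+a)) ≤ (1−θ)(m₂' − u z − u m₁)`, which follows
from `u·W(0) − W(h+a) ≤ W(h)` (top-affordability `y·h ≤ S`) and the pooled inequality `pooled_dear`. [this work] -/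
theorem gatedSliceMixLaw_regimeB_top_dear (y z g S lam : ℝ) (a j M h k₁ : ℕ)
    (hy0 : 0 < y) (hy1 : y < 1) (hz0 : 0 ≤ z) (hz1 : z < 1) (hg1 : g < 1) (hyg : y ≤ (1 - z) * g)
    (hS0 : 0 < S) (hta : y * (M : ℝ) ≤ S) (hhj : h ≤ j) (hhM : h ≤ M) (hSh : S < (h : ℝ))
    (hk : k₁ ≤ h) (hlam0 : 0 ≤ lam) (hlam1 : lam ≤ 1) (hmean : (1 - z) * ((k₁ : ℝ) + ((h : ℝ) - k₁) * lam) = S)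
    (hk₁j : k₁ ≤ j) (hk1low : 2 * (k₁ : ℝ) < S + (a : ℝ) * g * (1 - z))
    (hllow : 2 * ((k₁ + a : ℕ) : ℝ) < S + (a : ℝ) * g * (1 - z)) (hlj : k₁ + a ≤ j) (hhaG : j + 1 ≤ h + a)
    (hmid : S + (a : ℝ) * g * (1 - z) ≤ 2 * (h : ℝ))
    (hdear : y * ((h : ℝ) - k₁) ≤ S + (a : ℝ) * g * (1 - z) - 2 * (k₁ : ℝ))
    (hsat : (1 - z) * lam * (1 - g) ≤ usage y (S + (a : ℝ) * g * (1 - z)) j (k₁ + a) h * ((1 - z) * (1 - lam) * g)) :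
    ∃ θ : ℝ, 0 ≤ θ ∧ θ < 1 ∧
      DECAtT y (S + (a : ℝ) * g * (1 - z)) j (M + a)
        (fun p => θ * weakMidLaw S g h a p
          + (1 - θ) * (z * (if p = 0 then (1 : ℝ) else 0) + (1 - z) * slice (fun q => TP[k₁, h, lam, q]) a g p)) := by
  classical
  set t : ℝ := S + (a : ℝ) * g * (1 - z) with ht
  have h1z : 0 < 1 - z := by linarith
  have hg0 : 0 < g := by nlinarith
  have h1y : 0 < 1 - y := by linarith
  have ha0 : (0 : ℝ) ≤ a := Nat.cast_nonneg a
  have hk0 : (0 : ℝ) ≤ k₁ := Nat.cast_nonneg k₁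
  have hh0 : (0 : ℝ) < h := lt_trans hS0 hSh
  have hyh : y * (h : ℝ) ≤ S := le_trans (mul_le_mul_of_nonneg_left (by exact_mod_cast hhM) hy0.le) hta
  have hlam0' : 0 ≤ 1 - lam := by linarith
  have hagwa : (a : ℝ) * g * (1 - z) ≤ a := by nlinarith [mul_nonneg ha0 hg0.le]
  have hcompd : t < ((k₁ + a : ℕ) : ℝ) + h := by push_cast; rw [ht]; linarith
  have hagw0 : 0 ≤ (a : ℝ) * g * (1 - z) := mul_nonneg (mul_nonneg ha0 hg0.le) h1z.le
  have ht0' : 2 * ((0 : ℕ) : ℝ) < t := by push_cast; rw [ht]; linarith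
  have hlh : k₁ + a < h := by
    have : ((k₁ + a : ℕ) : ℝ) < h := by push_cast at hllow hcompd ⊢; linarith
    exact_mod_cast this
  -- masses
  set m₁ : ℝ := (1 - z) * (1 - lam) * (1 - g) with hm₁
  set m₁' : ℝ := (1 - z) * (1 - lam) * g with hm₁'
  set m₂ : ℝ := (1 - z) * lam * (1 - g) with hm₂
  set m₂' : ℝ := (1 - z) * lam * g with hm₂'
  have hm₁0 : 0 ≤ m₁ := mul_nonneg (mul_nonneg h1z.le hlam0') (by linarith)
  have hm₁'0 : 0 ≤ m₁' := mul_nonneg (mul_nonneg h1z.le hlam0') hg0.le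
  set w₀ : ℝ := 1 - S / h with hw₀
  set Wh : ℝ := S / h * (1 - g) with hWh
  set WG : ℝ := S / h * g with hWG
  have hSh' : 0 < S / (h : ℝ) := div_pos hS0 hh0
  have hw0 : 0 ≤ w₀ := by rw [hw₀, sub_nonneg, div_le_one hh0]; exact hSh.le
  have hWhpos : 0 < Wh := mul_pos hSh' (by linarith)
  -- the rates and the kink
  set Ud : ℝ := usage y t j (k₁ + a) h with hUd
  have hUdpos : 0 < Ud := usage_pos_of_compat y t j (k₁ + a) h hy0 hy1 hllow hlh (Or.inr hcompd)
  set Δ : ℝ := Ud * m₁' - m₂ with hΔ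
  have hΔ0 : 0 ≤ Δ := by rw [hΔ]; linarith
  obtain ⟨θ, hθ⟩ : ∃ q : ℝ, q = Δ / (Δ + Wh) := ⟨_, rfl⟩
  have hden : 0 < Δ + Wh := by linarith
  have hθ0 : 0 ≤ θ := by rw [hθ]; exact div_nonneg hΔ0 hden.le
  have hθ1 : θ < 1 := by rw [hθ, div_lt_one hden]; linarith
  have h1θ : 0 < 1 - θ := by linarith
  have hkink : θ * Wh = (1 - θ) * Δ := by rw [hθ]; field_simp; ring
  -- the giant inequality
  have hu : y / (1 - y) * w₀ - WG ≤ Wh := by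
    -- u (1 − S/h) ≤ S/h  ⟸  y h ≤ S
    have h1 : y / (1 - y) * w₀ ≤ S / h := by
      rw [hw₀, show (1 : ℝ) - S / h = ((h : ℝ) - S) / h by field_simp, show y / (1 - y) * (((h : ℝ) - S) / h) = y * ((h : ℝ) - S) / ((1 - y) * h) by
        field_simp, div_le_div_iff₀ (mul_pos h1y hh0) hh0]
      have hx := mul_nonneg hh0.le (sub_nonneg.2 hyh)
      linarith [hx]
    have e : S / (h : ℝ) = WG + Wh := by rw [hWG, hWh]; ring
    linarith
  have hpool := pooled_dear y z g S lam j h a k₁ hy0 hy1 hz0 hz1.le hg0.le hg1.le hlam1 hhj hSh hyh hmean hllow hdear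
  rw [← hUd] at hpool
  have hG : y / (1 - y) * ((θ * w₀ + (1 - θ) * z) + (1 - θ) * m₁) ≤ θ * WG + (1 - θ) * m₂' := by
    -- θ e' ≤ θ Wh = (1−θ)Δ ≤ (1−θ)(m₂' − u z − u m₁)
    have h1 : θ * (y / (1 - y) * w₀ - WG) ≤ θ * Wh := mul_le_mul_of_nonneg_left hu hθ0
    have h2 : Δ ≤ m₂' - y / (1 - y) * z - y / (1 - y) * m₁ := by rw [hΔ, hm₁', hm₁, hm₂, hm₂']; linarith
    have h3 : (1 - θ) * Δ ≤ (1 - θ) * (m₂' - y / (1 - y) * z - y / (1 - y) * m₁) := mul_le_mul_of_nonneg_left h2 h1θ.le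
    linarith [h1, h3, hkink]
  -- piece 1: the shifted low fills the mid
  have P1 := flowAtT_pair y t j (M + a) (k₁ + a) h ((1 - θ) * m₁') (θ * Wh + (1 - θ) * m₂) hlj hllow (by omega) (Or.inr hmid)
    (Or.inr hcompd) (mul_nonneg h1θ.le hm₁'0) (by rw [← hUd]; nlinarith [hkink])
  -- piece 2: k₁ and the zeros ride the giant h + a
  have Pg : FlowAtT y t j (M + a) (fun p => (θ * w₀ + (1 - θ) * z) * (if p = 0 then (1 : ℝ) else 0)
      + (1 - θ) * m₁ * (if p = k₁ then (1 : ℝ) else 0) + (θ * WG + (1 - θ) * m₂') * (if p = h + a then (1 : ℝ) else 0)) := by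
    have hz' : 0 ≤ θ * w₀ + (1 - θ) * z := add_nonneg (mul_nonneg hθ0 hw0) (mul_nonneg h1θ.le hz0)
    have hG' : 0 ≤ θ * WG + (1 - θ) * m₂' :=
      add_nonneg (mul_nonneg hθ0 (mul_nonneg hSh'.le hg0.le)) (mul_nonneg h1θ.le (mul_nonneg (mul_nonneg h1z.le hlam0) hg0.le))
    refine flowAtT_of_giants y t j (M + a) _ hy0 hy1 (fun p => ?_) ?_
    · refine add_nonneg (add_nonneg (mul_nonneg hz' ?_) (mul_nonneg (mul_nonneg h1θ.le hm₁0) ?_)) (mul_nonneg hG' ?_) <;>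
        split_ifs <;> norm_num
    · have hl : ∑ l ∈ Finset.range (j + 1), (if 2 * (l : ℝ) < t then
          (θ * w₀ + (1 - θ) * z) * (if l = 0 then (1 : ℝ) else 0) + (1 - θ) * m₁ * (if l = k₁ then (1 : ℝ) else 0)
            + (θ * WG + (1 - θ) * m₂') * (if l = h + a then (1 : ℝ) else 0) else 0)
          = (θ * w₀ + (1 - θ) * z) + (1 - θ) * m₁ := by
        have e : ∀ l ∈ Finset.range (j + 1), (if 2 * (l : ℝ) < t then
            (θ * w₀ + (1 - θ) * z) * (if l = 0 then (1 : ℝ) else 0) + (1 - θ) * m₁ * (if l = k₁ then (1 : ℝ) else 0)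
              + (θ * WG + (1 - θ) * m₂') * (if l = h + a then (1 : ℝ) else 0) else 0)
            = (θ * w₀ + (1 - θ) * z) * (if l = 0 then (1 : ℝ) else 0) + (1 - θ) * m₁ * (if l = k₁ then (1 : ℝ) else 0) := by
          intro l hl
          have hl' : l ≤ j := Nat.lt_succ_iff.1 (Finset.mem_range.1 hl)
          rw [if_neg (show l ≠ h + a by omega)]
          by_cases hl0 : l = 0
          · subst hl0; rw [if_pos ht0']; ring
          · by_cases hl1 : l = k₁
            · subst hl1; rw [if_pos hk1low]; ring
            · rw [if_neg hl0, if_neg hl1]; split_ifs <;> ring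
        rw [Finset.sum_congr rfl e, Finset.sum_add_distrib, sum_mul_indicator (fun _ => θ * w₀ + (1 - θ) * z) j 0 (by omega),
          sum_mul_indicator (fun _ => (1 - θ) * m₁) j k₁ hk₁j]
      have hg' : ∑ p ∈ Finset.Ico (j + 1) (M + a + 1),
          ((θ * w₀ + (1 - θ) * z) * (if p = 0 then (1 : ℝ) else 0) + (1 - θ) * m₁ * (if p = k₁ then (1 : ℝ) else 0)
            + (θ * WG + (1 - θ) * m₂') * (if p = h + a then (1 : ℝ) else 0))
          = θ * WG + (1 - θ) * m₂' := by
        have e : ∀ p ∈ Finset.Ico (j + 1) (M + a + 1),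
            ((θ * w₀ + (1 - θ) * z) * (if p = 0 then (1 : ℝ) else 0) + (1 - θ) * m₁ * (if p = k₁ then (1 : ℝ) else 0)
              + (θ * WG + (1 - θ) * m₂') * (if p = h + a then (1 : ℝ) else 0))
              = (θ * WG + (1 - θ) * m₂') * (if p = h + a then (1 : ℝ) else 0) := by
          intro p hp
          have hp1 := (Finset.mem_Ico.1 hp).1
          rw [if_neg (show p ≠ 0 by omega), if_neg (show p ≠ k₁ by omega)]; ring
        rw [Finset.sum_congr rfl e, ← Finset.mul_sum, Finset.sum_ite_eq' (Finset.Ico (j + 1) (M + a + 1)) (h + a),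
          if_pos (Finset.mem_Ico.2 ⟨hhaG, by omega⟩)]
        ring
      rw [hl, hg']
      exact hG
  -- assemble
  have hsum := FlowAtT.add P1 Pg
  have hflow : FlowAtT y t j (M + a) (fun p => θ * weakMidLaw S g h a p
      + (1 - θ) * (z * (if p = 0 then (1 : ℝ) else 0) + (1 - z) * slice (fun q => TP[k₁, h, lam, q]) a g p)) := by
    refine (congrArg (FlowAtT y t j (M + a)) (funext fun p => ?_)).mp hsum
    rw [movedTwoPoint_apply, ← hm₁, ← hm₁', ← hm₂, ← hm₂']
    unfold weakMidLaw
    rw [← hw₀, ← hWh, ← hWG]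
    ring
  exact gatedSliceMixLaw_conclusion_of_flowAtT y z g S lam θ a j M h k₁ h hy0 hy1 hhM hk hhM hθ0 hθ1 hflow

set_option maxHeartbeats 400000 in
/-- **REGIME B, `k₂ = h`, CHEAP `k₁`, SATURATED mid — the conclusion of `GatedSliceMixLaw'`.**  As `gatedSliceMixLaw_regimeB_top_dear`, but
the pair `(k₁, h)` is LIGHT at `t` (`t − 2k₁ ≤ y(h − k₁)`: the unshifted low is cheaper in the mid than in a giant, `U₁ = usage y t j k₁ h ≤ u`),
and the mid is saturated by BOTH lows (`m₂ ≤ U_d m₁' + U₁ m₁`).  Certificate: `θ = Δ/(Δ + W(h))`, `Δ = U_d m₁' + U₁ m₁ − m₂` (the second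
kink, lead g32's K2 / arm-3 g64's `θ_all`): both lows ride the mid, every zero rides the giant; the giant inequality follows from
`u·W(0) − W(h+a) ≤ W(h)` and `pooled_cheap`. [this work] -/
theorem gatedSliceMixLaw_regimeB_top_cheap (y z g S lam : ℝ) (a j M h k₁ : ℕ)
    (hy0 : 0 < y) (hy1 : y < 1) (hz0 : 0 ≤ z) (hz1 : z < 1) (hg1 : g < 1) (hyg : y ≤ (1 - z) * g)
    (hS0 : 0 < S) (hta : y * (M : ℝ) ≤ S) (hhj : h ≤ j) (hhM : h ≤ M) (hSh : S < (h : ℝ))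
    (hk : k₁ ≤ h) (hlam0 : 0 ≤ lam) (hlam1 : lam ≤ 1) (hmean : (1 - z) * ((k₁ : ℝ) + ((h : ℝ) - k₁) * lam) = S)
    (hk₁j : k₁ ≤ j) (hk1low : 2 * (k₁ : ℝ) < S + (a : ℝ) * g * (1 - z))
    (hllow : 2 * ((k₁ + a : ℕ) : ℝ) < S + (a : ℝ) * g * (1 - z)) (hlj : k₁ + a ≤ j) (hhaG : j + 1 ≤ h + a)
    (hmid : S + (a : ℝ) * g * (1 - z) ≤ 2 * (h : ℝ))
    (hcheap : S + (a : ℝ) * g * (1 - z) - 2 * (k₁ : ℝ) ≤ y * ((h : ℝ) - k₁))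
    (hsat : (1 - z) * lam * (1 - g) ≤ usage y (S + (a : ℝ) * g * (1 - z)) j (k₁ + a) h * ((1 - z) * (1 - lam) * g)
      + usage y (S + (a : ℝ) * g * (1 - z)) j k₁ h * ((1 - z) * (1 - lam) * (1 - g))) :
    ∃ θ : ℝ, 0 ≤ θ ∧ θ < 1 ∧
      DECAtT y (S + (a : ℝ) * g * (1 - z)) j (M + a)
        (fun p => θ * weakMidLaw S g h a p
          + (1 - θ) * (z * (if p = 0 then (1 : ℝ) else 0) + (1 - z) * slice (fun q => TP[k₁, h, lam, q]) a g p)) := by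
  classical
  set t : ℝ := S + (a : ℝ) * g * (1 - z) with ht
  have h1z : 0 < 1 - z := by linarith
  have hg0 : 0 < g := by nlinarith
  have h1y : 0 < 1 - y := by linarith
  have ha0 : (0 : ℝ) ≤ a := Nat.cast_nonneg a
  have hk0 : (0 : ℝ) ≤ k₁ := Nat.cast_nonneg k₁
  have hh0 : (0 : ℝ) < h := lt_trans hS0 hSh
  have hyh : y * (h : ℝ) ≤ S := le_trans (mul_le_mul_of_nonneg_left (by exact_mod_cast hhM) hy0.le) hta
  have hlam0' : 0 ≤ 1 - lam := by linarith
  have hagwa : (a : ℝ) * g * (1 - z) ≤ a := by nlinarith [mul_nonneg ha0 hg0.le]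
  have hcompd : t < ((k₁ + a : ℕ) : ℝ) + h := by push_cast; rw [ht]; linarith
  have hagw0 : 0 ≤ (a : ℝ) * g * (1 - z) := mul_nonneg (mul_nonneg ha0 hg0.le) h1z.le
  have ht0' : 2 * ((0 : ℕ) : ℝ) < t := by push_cast; rw [ht]; linarith
  have hcomp1 : t < (k₁ : ℝ) + h := by nlinarith
  have hlh : k₁ + a < h := by
    have : ((k₁ + a : ℕ) : ℝ) < h := by push_cast at hllow hcompd ⊢; linarith
    exact_mod_cast this
  have hk1h : k₁ < h := by omega
  -- masses
  set m₁ : ℝ := (1 - z) * (1 - lam) * (1 - g) with hm₁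
  set m₁' : ℝ := (1 - z) * (1 - lam) * g with hm₁'
  set m₂ : ℝ := (1 - z) * lam * (1 - g) with hm₂
  set m₂' : ℝ := (1 - z) * lam * g with hm₂'
  have hm₁0 : 0 ≤ m₁ := mul_nonneg (mul_nonneg h1z.le hlam0') (by linarith)
  have hm₁'0 : 0 ≤ m₁' := mul_nonneg (mul_nonneg h1z.le hlam0') hg0.le
  set w₀ : ℝ := 1 - S / h with hw₀
  set Wh : ℝ := S / h * (1 - g) with hWh
  set WG : ℝ := S / h * g with hWG
  have hSh' : 0 < S / (h : ℝ) := div_pos hS0 hh0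
  have hw0 : 0 ≤ w₀ := by rw [hw₀, sub_nonneg, div_le_one hh0]; exact hSh.le
  have hWhpos : 0 < Wh := mul_pos hSh' (by linarith)
  -- the rates and the kink
  set Ud : ℝ := usage y t j (k₁ + a) h with hUd
  set U1 : ℝ := usage y t j k₁ h with hU1
  have hUdpos : 0 < Ud := usage_pos_of_compat y t j (k₁ + a) h hy0 hy1 hllow hlh (Or.inr hcompd)
  have hU1pos : 0 < U1 := usage_pos_of_compat y t j k₁ h hy0 hy1 hk1low hk1h (Or.inr hcomp1)
  set Δ : ℝ := Ud * m₁' + U1 * m₁ - m₂ with hΔ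
  have hΔ0 : 0 ≤ Δ := by rw [hΔ]; linarith
  obtain ⟨θ, hθ⟩ : ∃ q : ℝ, q = Δ / (Δ + Wh) := ⟨_, rfl⟩
  have hden : 0 < Δ + Wh := by linarith
  have hθ0 : 0 ≤ θ := by rw [hθ]; exact div_nonneg hΔ0 hden.le
  have hθ1 : θ < 1 := by rw [hθ, div_lt_one hden]; linarith
  have h1θ : 0 < 1 - θ := by linarith
  have hkink : θ * Wh = (1 - θ) * Δ := by rw [hθ]; field_simp; ring
  -- the giant inequality
  have hu : y / (1 - y) * w₀ - WG ≤ Wh := by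
    have h1 : y / (1 - y) * w₀ ≤ S / h := by
      rw [hw₀, show (1 : ℝ) - S / h = ((h : ℝ) - S) / h by field_simp, show y / (1 - y) * (((h : ℝ) - S) / h) = y * ((h : ℝ) - S) / ((1 - y) * h) by
        field_simp, div_le_div_iff₀ (mul_pos h1y hh0) hh0]
      have hx := mul_nonneg hh0.le (sub_nonneg.2 hyh)
      linarith [hx]
    have e : S / (h : ℝ) = WG + Wh := by rw [hWG, hWh]; ring
    linarith
  have hpool := pooled_cheap y z g S lam j h a k₁ hy0 hy1 hz0 hz1.le hg0.le hg1.le hlam1 hhj hSh hyh hmean hllow hmid hcheap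
  rw [← hUd, ← hU1] at hpool
  have hG : y / (1 - y) * (θ * w₀ + (1 - θ) * z) ≤ θ * WG + (1 - θ) * m₂' := by
    have h1 : θ * (y / (1 - y) * w₀ - WG) ≤ θ * Wh := mul_le_mul_of_nonneg_left hu hθ0
    have h2 : Δ ≤ m₂' - y / (1 - y) * z := by rw [hΔ, hm₁', hm₁, hm₂, hm₂']; linarith
    have h3 : (1 - θ) * Δ ≤ (1 - θ) * (m₂' - y / (1 - y) * z) := mul_le_mul_of_nonneg_left h2 h1θ.le
    linarith [h1, h3, hkink]
  -- piece 1: the shifted low into the mid (exactly its usage)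
  have P1 := flowAtT_pair y t j (M + a) (k₁ + a) h ((1 - θ) * m₁') (Ud * ((1 - θ) * m₁')) hlj hllow (by omega) (Or.inr hmid)
    (Or.inr hcompd) (mul_nonneg h1θ.le hm₁'0) (by rw [← hUd])
  -- piece 2: the unshifted low into the rest of the mid
  have P2 := flowAtT_pair y t j (M + a) k₁ h ((1 - θ) * m₁) (θ * Wh + (1 - θ) * m₂ - Ud * ((1 - θ) * m₁')) hk₁j hk1low (by omega)
    (Or.inr hmid) (Or.inr hcomp1) (mul_nonneg h1θ.le hm₁0) (by rw [← hU1]; nlinarith [hkink])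
  -- piece 3: the zeros ride the giant h + a
  have Pg : FlowAtT y t j (M + a) (fun p => (θ * w₀ + (1 - θ) * z) * (if p = 0 then (1 : ℝ) else 0)
      + (θ * WG + (1 - θ) * m₂') * (if p = h + a then (1 : ℝ) else 0)) := by
    have hz' : 0 ≤ θ * w₀ + (1 - θ) * z := add_nonneg (mul_nonneg hθ0 hw0) (mul_nonneg h1θ.le hz0)
    have hG' : 0 ≤ θ * WG + (1 - θ) * m₂' :=
      add_nonneg (mul_nonneg hθ0 (mul_nonneg hSh'.le hg0.le)) (mul_nonneg h1θ.le (mul_nonneg (mul_nonneg h1z.le hlam0) hg0.le))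
    refine flowAtT_of_giants y t j (M + a) _ hy0 hy1 (fun p => ?_) ?_
    · refine add_nonneg (mul_nonneg hz' ?_) (mul_nonneg hG' ?_) <;> split_ifs <;> norm_num
    · have hl : ∑ l ∈ Finset.range (j + 1), (if 2 * (l : ℝ) < t then
          (θ * w₀ + (1 - θ) * z) * (if l = 0 then (1 : ℝ) else 0) + (θ * WG + (1 - θ) * m₂') * (if l = h + a then (1 : ℝ) else 0) else 0)
          = θ * w₀ + (1 - θ) * z := by
        have e : ∀ l ∈ Finset.range (j + 1), (if 2 * (l : ℝ) < t then
            (θ * w₀ + (1 - θ) * z) * (if l = 0 then (1 : ℝ) else 0) + (θ * WG + (1 - θ) * m₂') * (if l = h + a then (1 : ℝ) else 0) else 0)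
            = (θ * w₀ + (1 - θ) * z) * (if l = 0 then (1 : ℝ) else 0) := by
          intro l hl
          have hl' : l ≤ j := Nat.lt_succ_iff.1 (Finset.mem_range.1 hl)
          rw [if_neg (show l ≠ h + a by omega)]
          by_cases hl0 : l = 0
          · subst hl0; rw [if_pos ht0']; ring
          · rw [if_neg hl0]; split_ifs <;> ring
        rw [Finset.sum_congr rfl e]
        exact sum_mul_indicator (fun _ => θ * w₀ + (1 - θ) * z) j 0 (by omega)
      have hg' : ∑ p ∈ Finset.Ico (j + 1) (M + a + 1),
          ((θ * w₀ + (1 - θ) * z) * (if p = 0 then (1 : ℝ) else 0) + (θ * WG + (1 - θ) * m₂') * (if p = h + a then (1 : ℝ) else 0))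
          = θ * WG + (1 - θ) * m₂' := by
        have e : ∀ p ∈ Finset.Ico (j + 1) (M + a + 1),
            ((θ * w₀ + (1 - θ) * z) * (if p = 0 then (1 : ℝ) else 0) + (θ * WG + (1 - θ) * m₂') * (if p = h + a then (1 : ℝ) else 0))
              = (θ * WG + (1 - θ) * m₂') * (if p = h + a then (1 : ℝ) else 0) := by
          intro p hp
          have hp1 := (Finset.mem_Ico.1 hp).1
          rw [if_neg (show p ≠ 0 by omega)]; ring
        rw [Finset.sum_congr rfl e, ← Finset.mul_sum, Finset.sum_ite_eq' (Finset.Ico (j + 1) (M + a + 1)) (h + a),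
          if_pos (Finset.mem_Ico.2 ⟨hhaG, by omega⟩)]
        ring
      rw [hl, hg']
      exact hG
  -- assemble
  have hsum := FlowAtT.add (FlowAtT.add P1 P2) Pg
  have hflow : FlowAtT y t j (M + a) (fun p => θ * weakMidLaw S g h a p
      + (1 - θ) * (z * (if p = 0 then (1 : ℝ) else 0) + (1 - z) * slice (fun q => TP[k₁, h, lam, q]) a g p)) := by
    refine (congrArg (FlowAtT y t j (M + a)) (funext fun p => ?_)).mp hsum
    rw [movedTwoPoint_apply, ← hm₁, ← hm₁', ← hm₂, ← hm₂']
    unfold weakMidLaw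
    rw [← hw₀, ← hWh, ← hWG]
    ring
  exact gatedSliceMixLaw_conclusion_of_flowAtT y z g S lam θ a j M h k₁ h hy0 hy1 hhM hk hhM hθ0 hθ1 hflow

end LawDec

end Quant

end Summit.CriticalPhenomena.PercolationContinuityZ3.Theorems
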